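import Literature.AnabelianGeometry.EtaleTheta.Discharge.Sec5Def54ClausesOfUnitsEmbedding
import Literature.AnabelianGeometry.EtaleTheta.ThetaSubquotientOfThetaSetting
import Mathlib.GroupTheory.Index

/-!
# [EtTh] Definition 5.4 (b) AT THE PINNED theta subquotient: for a CYCLIC `(l·Δ_Θ)_E`, `#((l·Δ_Θ)_E ⊗ ℤ/Nℤ) = gcd(#(l·Δ_Θ)_E, N)`;
# at the pin `Q := ofSettingSub D l U` and `E = U/V`, clause (b) ⟸ ONE subgroup equality `l·Δ_Θ ∩ q(V) = Ker(μ_N-reduction)`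

Mochizuki, *The étale theta function and its Frobenioid-theoretic manifestations*, Publ. RIMS **45** (2009), Def. 5.4 (b) p.327
(PDF p.101): «(b) `(l·Δ_Θ)_S ⊗ ℤ/Nℤ` is of cardinality `N`»; §5 p.327: «`(l·Δ_Θ)_D ⊆ Aut^Θ_D(D)`» — the image of `l·Δ_Θ (≅ l·Ẑ(1))`
in the (finite) automorphism group of a covering, a finite CYCLIC group.  [cite: MochizukiEtTh2009, Def 5.4 p.327 (PDF p.101)]

abc-iut cell, layer L2, seat abc-iut-L2-t4 (gen 9; Def. 5.4 typer of record), row «DEF54b-INDEX» (abc-iut-L2-lead R1209 GO (4); VNEXT add.13/14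
«DEF54b-INDEX@FOURTH-MODEL» crux (★)).  PROOF-ONLY sequel of `Sec5Def54ClausesOfUnitsEmbedding.lean` (p498191): no definition, no new `Prop`, no
instance, no notation; nothing landed is edited or restated.  Consumed BY NAME: abc-iut-L2-t9's pin `ThetaSubquotient.ofSettingSub` /
`lDeltaQEquivOfSettingSub` (`ThetaSubquotientOfThetaSetting.lean`), abc-iut-L2-t8's `ThetaSetting.CyclotomeMod` (`red`, onto `μ_N(ℚ̄_p)`),
`card_MuN`; Mathlib `IsCyclic`, `Subgroup.index`, `QuotientGroup.quotientKerEquivOfSurjective`.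

WHAT IS PROVED.
* (private group theory) in a finite cyclic group `G`, the quotient `G / G^N` by the `N`-th powers has `gcd(#G, N)` elements (the
  `N`-th powers are the powers of `g^N` for a generator `g`, of order `#G / gcd(#G, N)`);
* `ThetaSubquotientStub.card_lDelta_quotient_pow_eq_gcd` / `_eq_iff_dvd` — the same READ ON A STUB `Q` at an object `E` of the base
  (applies to abc-iut-L2-t9's pinned instances before any §5 datum is attached);
* `ThetaFrobenioid.card_lDeltaModN_eq_gcd` — for every §5 datum and object `S` with `(l·Δ_Θ)_S` finite cyclic:
  `#((l·Δ_Θ)_S ⊗ ℤ/Nℤ) = gcd(#(l·Δ_Θ)_S, N)`; hence `card_lDeltaModN_of_dvd_card` (clause (b) when `N ∣ #(l·Δ_Θ)_S`) and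
  **`card_lDeltaModN_eq_iff_dvd`** — clause (b) holds IFF `N ∣ #(l·Δ_Θ)_S`.  At a pinned stub (abc-iut-L2-t9's
  `lDeltaQEquiv…`: `(l·Δ_Θ)_{Π/V} ≃ L ⧸ (L ∩ q(V))`) this turns clause (b) into the index condition `N ∣ [L : L ∩ q(V)]` on the named
  open subgroup `V` — the currency of the DEF54b sizings.
* **`ThetaSubquotient.card_lDeltaModN_ofSettingSub_of_inter_eq_ker_red`** — AT THE PIN `Q := ofSettingSub D l U` over `B^temp(U)⁰`
  (`U ⊆ Π^tp_X` tempered, `l·Δ_Θ ⊆ q(U)`), for the Galois object `E := U/V` (`V` open normal) and the junction's cyclotome datum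
  `μ : D.CyclotomeMod l N` (`red : l·Δ_Θ ↠ μ_N(ℚ̄_p)`, kernel the `N`-th powers): **clause (b) `#((l·Δ_Θ)_{U/V} ⊗ ℤ/Nℤ) = N` holds as soon
  as (★) `l·Δ_Θ ∩ q(V) = Ker(red)`** — then `(l·Δ_Θ)_{U/V} ≃ l·Δ_Θ ⧸ Ker(red) ≃ μ_N`, cyclic of order `N`; and the index form
  `card_lDelta_ofSettingSub_quotient_pow_eq_iff_dvd_index` — for a finite cyclic `l·Δ_Θ ⧸ (l·Δ_Θ ∩ q(V))`, clause (b) at `U/V` IFF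
  `N ∣ [l·Δ_Θ : l·Δ_Θ ∩ q(V)]`.
HONEST FRAMING: group theory over the typed §5 record; no carrier is claimed to instantiate Def. 5.4 here; nothing asserts such data exist for
an actual curve; [EtTh] is a refereed paper and nothing here bears on [IUTchIII] Cor. 3.12 — no side taken; typed ≠ proved except the
theorems below.
-/

namespace Literature.AnabelianGeometry.EtaleTheta

open CategoryTheory

universe w v v' u u'

namespace ThetaFrobenioid

/-! ### Group theory: the quotient of a finite cyclic group by its `N`-th powers -/

namespace CyclicQuot

variable {G : Type*} [CommGroup G]

/-- In a cyclic group generated by `g`, the `N`-th powers are exactly the powers of `g ^ N`. [folklore] -/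
private theorem range_powMonoidHom_eq_zpowers_pow {g : G} (hg : ∀ x, x ∈ Subgroup.zpowers g) (N : ℕ) :
    (powMonoidHom N : G →* G).range = Subgroup.zpowers (g ^ N) := by
  ext x
  constructor
  · rintro ⟨y, rfl⟩
    obtain ⟨k, rfl⟩ := Subgroup.mem_zpowers_iff.mp (hg y)
    refine Subgroup.mem_zpowers_iff.mpr ⟨k, ?_⟩
    rw [powMonoidHom_apply, ← zpow_natCast, ← zpow_natCast, ← zpow_mul, ← zpow_mul, mul_comm]
  · intro hx
    obtain ⟨k, rfl⟩ := Subgroup.mem_zpowers_iff.mp hx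
    refine ⟨g ^ k, ?_⟩
    rw [powMonoidHom_apply, ← zpow_natCast, ← zpow_natCast, ← zpow_mul, ← zpow_mul, mul_comm]

/-- **In a finite cyclic group `G`, `G / G^N` has `gcd(#G, N)` elements** (`N ≥ 1`). [folklore] -/
private theorem card_quotient_range_powMonoidHom_eq_gcd [IsCyclic G] [Finite G] {N : ℕ} (hN : N ≠ 0) :
    Nat.card (G ⧸ (powMonoidHom N : G →* G).range) = Nat.gcd (Nat.card G) N := by
  obtain ⟨g, hg⟩ := IsCyclic.exists_generator (α := G)
  have hordg : orderOf g = Nat.card G := orderOf_eq_card_of_forall_mem_zpowers hg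
  have hcardH : Nat.card ((powMonoidHom N : G →* G).range) = Nat.card G / Nat.gcd (Nat.card G) N := by
    rw [range_powMonoidHom_eq_zpowers_pow hg N, Nat.card_zpowers, orderOf_pow' g hN, hordg]
  have hidx := Subgroup.index_mul_card ((powMonoidHom N : G →* G).range)
  rw [hcardH] at hidx
  have hpos : 0 < Nat.card G := Nat.card_pos
  set d := Nat.gcd (Nat.card G) N with hd
  have hgpos : 0 < d := Nat.gcd_pos_of_pos_left _ hpos
  have hdvd : d ∣ Nat.card G := Nat.gcd_dvd_left _ _
  have hqpos : 0 < Nat.card G / d := Nat.div_pos (Nat.le_of_dvd hpos hdvd) hgpos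
  have h2 : (powMonoidHom N : G →* G).range.index * (Nat.card G / d) = d * (Nat.card G / d) := by
    rw [hidx, Nat.mul_div_cancel' hdvd]
  exact Nat.eq_of_mul_eq_mul_right hqpos h2

/-- Hence `#(G / G^N) = N` iff `N ∣ #G` (finite cyclic `G`, `N ≥ 1`). [folklore] -/
private theorem card_quotient_range_powMonoidHom_eq_iff_dvd [IsCyclic G] [Finite G] {N : ℕ} (hN : N ≠ 0) :
    Nat.card (G ⧸ (powMonoidHom N : G →* G).range) = N ↔ N ∣ Nat.card G := by
  rw [card_quotient_range_powMonoidHom_eq_gcd hN]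
  exact ⟨fun h => h ▸ Nat.gcd_dvd_left _ _, fun h => Nat.gcd_eq_right h⟩

end CyclicQuot

/-! ### At the level of the theta-subquotient stub (any pinned `Q`, any object `E` of the base) -/

/-- **`#((l·Δ_Θ)_E ⊗ ℤ/Nℤ) = gcd(#(l·Δ_Θ)_E, N)`** for the theta subquotients `(l·Δ_Θ)_E` of a stub `Q` (§5 p.327: the image of
`l·Δ_Θ` in `Aut^Θ_D(E)`) whenever `(l·Δ_Θ)_E` is finite cyclic — stated on the stub, so that it applies to abc-iut-L2-t9's pinned
instances (`(l·Δ_Θ)_{Π/V} ≃ L ⧸ (L ∩ q(V))`) before any §5 datum is attached. [cite: MochizukiEtTh2009, Def 5.4 p.327 (PDF p.101)] -/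
theorem _root_.Literature.AnabelianGeometry.EtaleTheta.FrobenioidTheta.ThetaSubquotientStub.card_lDelta_quotient_pow_eq_gcd
    {D : Type u'} [Category.{v'} D] (Q : FrobenioidTheta.ThetaSubquotientStub.{w} D) (E : D) (N : ℕ+)
    [IsCyclic (Q.lDelta E)] [Finite (Q.lDelta E)] :
    Nat.card (Q.lDelta E ⧸ (powMonoidHom (N : ℕ) : Q.lDelta E →* Q.lDelta E).range) = Nat.gcd (Nat.card (Q.lDelta E)) N :=
  CyclicQuot.card_quotient_range_powMonoidHom_eq_gcd N.ne_zero

/-- … hence `#((l·Δ_Θ)_E ⊗ ℤ/Nℤ) = N` IFF `N ∣ #(l·Δ_Θ)_E` (clause (b) of Def. 5.4 at `E` as an INDEX condition).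
[cite: MochizukiEtTh2009, Def 5.4 p.327 (PDF p.101)] -/
theorem _root_.Literature.AnabelianGeometry.EtaleTheta.FrobenioidTheta.ThetaSubquotientStub.card_lDelta_quotient_pow_eq_iff_dvd
    {D : Type u'} [Category.{v'} D] (Q : FrobenioidTheta.ThetaSubquotientStub.{w} D) (E : D) (N : ℕ+)
    [IsCyclic (Q.lDelta E)] [Finite (Q.lDelta E)] :
    Nat.card (Q.lDelta E ⧸ (powMonoidHom (N : ℕ) : Q.lDelta E →* Q.lDelta E).range) = N ↔ (N : ℕ) ∣ Nat.card (Q.lDelta E) :=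
  CyclicQuot.card_quotient_range_powMonoidHom_eq_iff_dvd N.ne_zero

/-! ### Def. 5.4 (b) for a cyclic `(l·Δ_Θ)_S` -/

variable {C : Type u} [Category.{v} C] {D : Type u'} [Category.{v'} D] (𝔉 : ThetaFrobenioid.{w} C D)

/-- **`#((l·Δ_Θ)_S ⊗ ℤ/Nℤ) = gcd(#(l·Δ_Θ)_S, N)`** for every §5 datum and every object `S` whose theta subquotient `(l·Δ_Θ)_S` is finite
cyclic (print: the image of `l·Δ_Θ ≅ l·Ẑ(1)` in the automorphism group of a covering). [cite: MochizukiEtTh2009, Def 5.4 p.327 (PDF p.101)] -/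
theorem card_lDeltaModN_eq_gcd (S : C) [IsCyclic (𝔉.lDeltaObj S)] [Finite (𝔉.lDeltaObj S)] :
    Nat.card (𝔉.lDeltaModN S) = Nat.gcd (Nat.card (𝔉.lDeltaObj S)) 𝔉.N :=
  CyclicQuot.card_quotient_range_powMonoidHom_eq_gcd 𝔉.N.ne_zero

/-- **Def. 5.4 (b) holds as soon as `N ∣ #(l·Δ_Θ)_S`** (cyclic finite `(l·Δ_Θ)_S`). [cite: MochizukiEtTh2009, Def 5.4 p.327 (PDF p.101)] -/
theorem card_lDeltaModN_of_dvd_card (S : C) [IsCyclic (𝔉.lDeltaObj S)] [Finite (𝔉.lDeltaObj S)]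
    (h : (𝔉.N : ℕ) ∣ Nat.card (𝔉.lDeltaObj S)) : Nat.card (𝔉.lDeltaModN S) = 𝔉.N :=
  (CyclicQuot.card_quotient_range_powMonoidHom_eq_iff_dvd 𝔉.N.ne_zero).mpr h

/-- **Def. 5.4 (b) for a cyclic finite `(l·Δ_Θ)_S` holds IFF `N ∣ #(l·Δ_Θ)_S`** — at a pinned stub (`(l·Δ_Θ)_{Π/V} ≃ L ⧸ (L ∩ q(V))`)
the index condition `N ∣ [L : L ∩ q(V)]` on the named open subgroup `V`. [cite: MochizukiEtTh2009, Def 5.4 p.327 (PDF p.101)] -/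
theorem card_lDeltaModN_eq_iff_dvd (S : C) [IsCyclic (𝔉.lDeltaObj S)] [Finite (𝔉.lDeltaObj S)] :
    Nat.card (𝔉.lDeltaModN S) = 𝔉.N ↔ (𝔉.N : ℕ) ∣ Nat.card (𝔉.lDeltaObj S) :=
  CyclicQuot.card_quotient_range_powMonoidHom_eq_iff_dvd 𝔉.N.ne_zero

/-- Transport form: an identification `(l·Δ_Θ)_S ≃* G` with a finite cyclic group of order `M` gives `#((l·Δ_Θ)_S ⊗ ℤ/N) = gcd(M, N)`.
[cite: MochizukiEtTh2009, Def 5.4 p.327 (PDF p.101)] -/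
theorem card_lDeltaModN_eq_gcd_of_mulEquiv (S : C) {G : Type*} [CommGroup G] [IsCyclic G] [Finite G] (e : 𝔉.lDeltaObj S ≃* G) :
    Nat.card (𝔉.lDeltaModN S) = Nat.gcd (Nat.card G) 𝔉.N := by
  haveI : Finite (𝔉.lDeltaObj S) := Finite.of_equiv _ e.symm.toEquiv
  haveI : IsCyclic (𝔉.lDeltaObj S) := isCyclic_of_surjective e.symm.toMonoidHom e.symm.surjective
  rw [𝔉.card_lDeltaModN_eq_gcd S, Nat.card_congr e.toEquiv]

/-- In particular `(l·Δ_Θ)_S ≃ ℤ/Mℤ` (`M ≥ 1`) gives clause (b) iff `N ∣ M`. [cite: MochizukiEtTh2009, Def 5.4 p.327 (PDF p.101)] -/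
theorem card_lDeltaModN_eq_iff_dvd_of_mulEquiv_zmod (S : C) {M : ℕ} [NeZero M] (e : 𝔉.lDeltaObj S ≃* Multiplicative (ZMod M)) :
    Nat.card (𝔉.lDeltaModN S) = 𝔉.N ↔ (𝔉.N : ℕ) ∣ M := by
  have hM : Nat.card (Multiplicative (ZMod M)) = M := by
    show Nat.card (ZMod M) = M
    exact Nat.card_zmod M
  rw [𝔉.card_lDeltaModN_eq_gcd_of_mulEquiv S e, hM]
  exact ⟨fun h => h ▸ Nat.gcd_dvd_left _ _, fun h => Nat.gcd_eq_right h⟩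

end ThetaFrobenioid

/-! ### At abc-iut-L2-t9's PIN `ofSettingSub D l U`: clause (b) for `E = U/V` from ONE subgroup equality (★) -/

namespace ThetaSubquotient

open Literature.AlgebraicGeometry.Frobenioids Literature.AnabelianGeometry.SemiGraphs
open scoped IsMulCommutative

variable {p : ℕ} [Fact p.Prime] (D : ThetaSetting p) (l : ℕ) (U : Subgroup D.PiTemp) [IsTopologicalGroup ↥U]

/-- **[EtTh] Def. 5.4 (b) at the pinned theta subquotient, for the Galois object `U/V`, from (★)**: over `B^temp(U)⁰` (`U ⊆ Π^tp_X`
tempered, `l·Δ_Θ ⊆ q(U)` — the double underline situation), with the junction's cyclotome datum `μ : D.CyclotomeMod l N` («the natural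
isomorphism `μ_N ≅ (l·Δ_Θ) ⊗ ℤ/Nℤ`», p.46: `red : l·Δ_Θ ↠ μ_N(ℚ̄_p)` with kernel the `N`-th powers), IF the named open normal `V ⊆ U`
satisfies (★) `l·Δ_Θ ∩ q(V) = Ker(red)` — i.e. `q(V)` meets `l·Δ_Θ` exactly in `N·(l·Δ_Θ)` — THEN `(l·Δ_Θ)_{U/V} ≃ μ_N` and
«`(l·Δ_Θ)_{U/V} ⊗ ℤ/Nℤ` is of cardinality `N`».  (★) is the located crux of the DEF54b rows (which `V` plays `B_N^bs`).
[cite: MochizukiEtTh2009, Def 5.4 p.327 (PDF p.101); Def 2.13 p.272 (PDF p.46)] -/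
theorem card_lDeltaModN_ofSettingSub_of_inter_eq_ker_red (hU : IsTempered ↥U) (hL : (ιTheta D l).range ≤ (qSub D U).range)
    (V : OpenNormalSubgroup ↥U) {N : ℕ+} (μ : D.CyclotomeMod l N)
    (hstar : (V.toSubgroup.map (qSub D U) ⊓ (ιTheta D l).range).comap (ιTheta D l) = μ.red.ker) :
    Nat.card ((ofSettingSub D l U).lDelta ⟨BTemp.Q hU V, isConnectedObj_Q hU V⟩ ⧸
      (powMonoidHom (N : ℕ) : (ofSettingSub D l U).lDelta ⟨BTemp.Q hU V, isConnectedObj_Q hU V⟩ →*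
        (ofSettingSub D l U).lDelta ⟨BTemp.Q hU V, isConnectedObj_Q hU V⟩).range) = N := by
  -- `(l·Δ_Θ)_{U/V} ≃* l·Δ_Θ ⧸ (l·Δ_Θ ∩ q(V)) = l·Δ_Θ ⧸ Ker(red) ≃* μ_N`
  have e : (ofSettingSub D l U).lDelta ⟨BTemp.Q hU V, isConnectedObj_Q hU V⟩ ≃* MuN p N :=
    ((lDeltaQEquivOfSettingSub D l U hU hL V).trans (QuotientGroup.quotientMulEquivOfEq hstar)).trans
      (QuotientGroup.quotientKerEquivOfSurjective μ.red μ.red_surjective)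
  haveI : Finite ((ofSettingSub D l U).lDelta ⟨BTemp.Q hU V, isConnectedObj_Q hU V⟩) := Finite.of_equiv _ e.symm.toEquiv
  haveI : IsCyclic ((ofSettingSub D l U).lDelta ⟨BTemp.Q hU V, isConnectedObj_Q hU V⟩) :=
    isCyclic_of_surjective e.symm.toMonoidHom e.symm.surjective
  refine ((ofSettingSub D l U).card_lDelta_quotient_pow_eq_iff_dvd _ N).mpr ?_
  rw [Nat.card_congr e.toEquiv, Nat.card_eq_fintype_card, card_MuN]

/-- **The index form at the pin** (no cyclotome datum): when `l·Δ_Θ ⧸ (l·Δ_Θ ∩ q(V))` is finite cyclic (the image of `l·Δ_Θ ≅ l·Ẑ(1)`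
in the finite group `Aut^Θ(U/V)`), clause (b) holds at `U/V` IFF `N ∣ [l·Δ_Θ : l·Δ_Θ ∩ q(V)]`.
[cite: MochizukiEtTh2009, Def 5.4 p.327 (PDF p.101)] -/
theorem card_lDelta_ofSettingSub_quotient_pow_eq_iff_dvd_index (hU : IsTempered ↥U)
    (hL : (ιTheta D l).range ≤ (qSub D U).range) (V : OpenNormalSubgroup ↥U) (N : ℕ+)
    [IsCyclic (↥(D.lDeltaTheta l) ⧸ (V.toSubgroup.map (qSub D U) ⊓ (ιTheta D l).range).comap (ιTheta D l))]
    [Finite (↥(D.lDeltaTheta l) ⧸ (V.toSubgroup.map (qSub D U) ⊓ (ιTheta D l).range).comap (ιTheta D l))] :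
    Nat.card ((ofSettingSub D l U).lDelta ⟨BTemp.Q hU V, isConnectedObj_Q hU V⟩ ⧸
      (powMonoidHom (N : ℕ) : (ofSettingSub D l U).lDelta ⟨BTemp.Q hU V, isConnectedObj_Q hU V⟩ →*
        (ofSettingSub D l U).lDelta ⟨BTemp.Q hU V, isConnectedObj_Q hU V⟩).range) = N ↔
      (N : ℕ) ∣ ((V.toSubgroup.map (qSub D U) ⊓ (ιTheta D l).range).comap (ιTheta D l)).index := by
  have e := lDeltaQEquivOfSettingSub D l U hU hL V
  haveI : Finite ((ofSettingSub D l U).lDelta ⟨BTemp.Q hU V, isConnectedObj_Q hU V⟩) := Finite.of_equiv _ e.symm.toEquiv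
  haveI : IsCyclic ((ofSettingSub D l U).lDelta ⟨BTemp.Q hU V, isConnectedObj_Q hU V⟩) :=
    isCyclic_of_surjective e.symm.toMonoidHom e.symm.surjective
  rw [(ofSettingSub D l U).card_lDelta_quotient_pow_eq_iff_dvd _ N, Nat.card_congr e.toEquiv, Subgroup.index]

end ThetaSubquotient

end Literature.AnabelianGeometry.EtaleTheta
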